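import Literature.AlgebraicGeometry.Resolution.IdealIntegralClosureCharts
import Literature.RingTheory.IntegralClosure.KrullIntersection
import Literature.AlgebraicGeometry.Resolution.IntegralClosureEssFiniteType
import Mathlib.RingTheory.Localization.FractionRing
import Mathlib.RingTheory.Localization.Ideal
import Mathlib.RingTheory.Localization.AtPrime.Basic
import Mathlib.RingTheory.Ideal.Height
import Mathlib.RingTheory.IntegralClosure.IntegrallyClosed
import HarnessLib

/-!
# Integral dependence on powers of an ideal: reduction to the height-one primes of the normalized charts

Topic `Literature/AlgebraicGeometry/Resolution` (sibling of `IdealIntegralClosure.lean`, `IdealIntegralClosureValuative.lean`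
and `IdealIntegralClosureCharts.lean`; the elementwise notion is the tree's `Hironaka2005.IsIntegralOverIdeal I x`).
Everything here is PROVED; no definitions, no named facts. For a Noetherian NORMAL domain `B` (Krull's
«`B = ⋂_{ht 𝔮 = 1} B_𝔮`», Matsumura Thm. 11.5; tree `Literature/RingTheory/IntegralClosure/KrullIntersection.lean`):

* `isDiscreteValuationRing_of_height_eq_one` — the local ring of `B` at a height-one prime is a discrete valuation
  ring (a normal Noetherian local domain of dimension one; Matsumura Thm. 11.2 / Cor. of Thm. 11.5);
* `mem_span_pow_of_forall_heightOne` — **height-one criterion for divisibility by `f^μ`**: `g ∈ f^μ B` as soon as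
  `g ∈ f^μ B_𝔮` for every height-one prime `𝔮` CONTAINING `f` (the primes avoiding `f` impose nothing);
  `mem_span_pow_of_forall_heightOne_localization` — the same with the hypothesis read in `Localization.AtPrime 𝔮`;
  `exists_algebraMap_eq_of_forall_heightOne_mem` — fraction-field form for an element with a denominator `d`;
* `div_pow_mem_of_forall_heightOne` — for a Noetherian `R`-subalgebra `B` of the fraction field `K` of `R` which is
  integrally closed in `K` (a normalized blow-up chart): `g/f^μ ∈ B` as soon as `g ∈ f^μ B_𝔮` for the height-one
  primes `𝔮 ∋ f` of `B`;
* `isIntegral_div_pow_of_forall_heightOne` — the same concluding «`g/f^μ` is integral over the chart ring `C`»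
  when `B` is the integral closure of `C` in `K` — exactly the hypothesis shape of the chart criterion
  `isIntegralOverIdeal_pow_of_forall_chart` (res-D-pv-012, `IdealIntegralClosureCharts.lean`);
* `isIntegralOverIdeal_pow_of_forall_chart_heightOne` — **the composite reduction**: for `I = (f_i)` in the domain
  `R`, `g` is integral over `I^μ` as soon as, for every `i` with `f_i ≠ 0` and every height-one prime `𝔮 ∋ f_i` of the
  (Noetherian) normalization `B_i` of the chart ring `R[I/f_i] ⊆ K`, `g ∈ f_i^μ (B_i)_𝔮` — i.e. it suffices to test
  the discrete valuations of the normalized blow-up of `I` centred over `V(I)` (Huneke–Swanson Thm. 10.2.2 (3) with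
  Prop. 4.1.1 / Krull).

## Why it is here

Cell `res-hironaka`, residual literature premise «(♭)⊆» of [Hironaka2005] §12 p.125 l.63–70 (tree shape: the hypothesis
of `Hironaka2005.jmax_flat_of_le`): steps S2/S4 of the sizing note `plan/tools/res-type-089/SIZING-F21e-flat.md` — the
reduction of «`g` integral over `(J♯)^μ`» to the inequalities `v_𝔮(g) ≥ μ·v_𝔮(f_i)` in the discrete valuation rings
`(B_i)_𝔮` of the normalized blow-up charts, where [Hironaka2005]'s numerical exponent and ambient reduction theorems
are then applied (steps S5–S10, other files). Pure commutative algebra: nothing of [Hironaka2005] or of the 2017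
manuscript is asserted here.

## Sources
* H. Matsumura, *Commutative Ring Theory* (1986), Thm. 11.2 (p. 79), Thm. 11.5 and Corollary (p. 82). [Matsumura1987]
* C. Huneke, I. Swanson, *Integral Closure of Ideals, Rings, and Modules*, LMS LN 336 (2006), Thm. 10.2.2 (3),
  Prop. 4.1.1. [HunekeSwanson2006]
-/

noncomputable section

namespace Literature.AlgebraicGeometry.Resolution

namespace Hironaka2005

/-! ## §1 Height-one primes of a Noetherian normal domain -/

section HeightOne

variable {B : Type*} [CommRing B] [IsDomain B] [IsNoetherianRing B] [IsIntegrallyClosed B]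

/-- **The local ring of a Noetherian normal domain at a height-one prime is a discrete valuation ring**
(it is a normal Noetherian local domain of dimension one; Matsumura Thm. 11.2 / Cor. of Thm. 11.5). Stated for any
localization `R` of `B` at `𝔮` (e.g. `Localization.AtPrime 𝔮`, whose `IsDomain` instance Mathlib provides).
[cite: Matsumura1987, Thm. 11.2 (p. 79) and Cor. to Thm. 11.5 (p. 82)] -/
theorem isDiscreteValuationRing_of_height_eq_one (𝔮 : Ideal B) [𝔮.IsPrime] (h𝔮 : 𝔮.height = 1)
    (R : Type*) [CommRing R] [IsDomain R] [Algebra B R] [IsLocalization.AtPrime R 𝔮] :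
    IsDiscreteValuationRing R := by
  haveI : IsLocalRing R := IsLocalization.AtPrime.isLocalRing R 𝔮
  haveI : IsNoetherianRing R := IsLocalization.isNoetherianRing 𝔮.primeCompl R inferInstance
  haveI : IsIntegrallyClosed R := isIntegrallyClosed_of_isLocalization R 𝔮.primeCompl 𝔮.primeCompl_le_nonZeroDivisors
  have hdim : ringKrullDim R ≤ 1 := by
    rw [IsLocalization.AtPrime.ringKrullDim_eq_height 𝔮 R, h𝔮]
    exact le_of_eq (by rfl)
  -- not a field: the maximal ideal `𝔮 R` is non-zero
  have hnf : ¬ IsField R := by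
    intro hF
    obtain ⟨x, hx𝔮, hx0⟩ := Submodule.exists_mem_ne_zero_of_ne_bot (Ideal.ne_bot_of_height_eq_one h𝔮)
    have hxm : algebraMap B R x ∈ IsLocalRing.maximalIdeal R := by
      rw [← IsLocalization.AtPrime.map_eq_maximalIdeal 𝔮 R]
      exact Ideal.mem_map_of_mem _ hx𝔮
    rw [(IsLocalRing.isField_iff_maximalIdeal_eq).mp hF, Ideal.mem_bot] at hxm
    exact hx0 ((IsLocalization.to_map_eq_zero_iff R 𝔮.primeCompl_le_nonZeroDivisors).mp hxm)
  haveI : Ring.KrullDimLE 1 R := Ring.krullDimLE_iff.mpr hdim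
  have hm : IsLocalRing.maximalIdeal R ≠ ⊥ := (IsLocalRing.isField_iff_maximalIdeal_eq.not.mp hnf)
  have htf : IsDiscreteValuationRing R ↔ IsIntegrallyClosed R ∧ ∃! P : Ideal R, P ≠ ⊥ ∧ P.IsPrime :=
    (IsDiscreteValuationRing.TFAE R hnf).out 0 3
  refine htf.mpr ⟨‹_›, IsLocalRing.maximalIdeal R, ⟨hm, inferInstance⟩, fun P hP => ?_⟩
  haveI := hP.2
  exact IsLocalRing.eq_maximalIdeal (hP.2.isMaximal_of_ne_bot hP.1)

/-- **Height-one criterion for divisibility by `f^μ` in a Noetherian normal domain** (Matsumura Thm. 11.5 (ii)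
«`B = ⋂_{ht 𝔮 = 1} B_𝔮`»): if `g ∈ f^μ B_𝔮` for every height-one prime `𝔮` CONTAINING `f` (`f ≠ 0`), then
`g ∈ f^μ B`; the height-one primes avoiding `f` impose nothing (`s = f^μ`). [cite: Matsumura1987, Thm. 11.5 (ii) (p. 82)] -/
theorem mem_span_pow_of_forall_heightOne {f : B} (hf : f ≠ 0) (μ : ℕ) {g : B}
    (h : ∀ 𝔮 : Ideal B, 𝔮.IsPrime → 𝔮.height = 1 → f ∈ 𝔮 → ∃ s ∉ 𝔮, s * g ∈ Ideal.span {f ^ μ}) :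
    g ∈ Ideal.span {f ^ μ} := by
  refine Literature.RingTheory.IntegralClosure.mem_span_singleton_of_forall_height_eq_one (pow_ne_zero μ hf)
    fun P hP hP1 => ?_
  by_cases hfP : f ∈ P
  · exact h P hP hP1 hfP
  · exact ⟨f ^ μ, fun hmem => hfP (hP.mem_of_pow_mem μ hmem), Ideal.mem_span_singleton'.mpr ⟨g, by ring⟩⟩

/-- **Height-one criterion, localized form**: if the image of `g` lies in `f^μ B_𝔮` inside the localization `B_𝔮`
for every height-one prime `𝔮 ∋ f` (`f ≠ 0`), then `g ∈ f^μ B`. [cite: Matsumura1987, Thm. 11.5 (ii) (p. 82)] -/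
theorem mem_span_pow_of_forall_heightOne_localization {f : B} (hf : f ≠ 0) (μ : ℕ) {g : B}
    (h : ∀ 𝔮 : Ideal B, [𝔮.IsPrime] → 𝔮.height = 1 → f ∈ 𝔮 →
      algebraMap B (Localization.AtPrime 𝔮) g ∈
        Ideal.span {algebraMap B (Localization.AtPrime 𝔮) f ^ μ}) :
    g ∈ Ideal.span {f ^ μ} := by
  refine mem_span_pow_of_forall_heightOne hf μ fun 𝔮 h𝔮 h1 hf𝔮 => ?_
  haveI := h𝔮
  have hmem := h 𝔮 h1 hf𝔮
  rw [← map_pow, ← Set.image_singleton, ← Ideal.map_span] at hmem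
  obtain ⟨⟨⟨y, hy⟩, ⟨s, hs⟩⟩, hys⟩ := (IsLocalization.mem_map_algebraMap_iff 𝔮.primeCompl _).mp hmem
  refine ⟨s, hs, ?_⟩
  have hinj := IsLocalization.injective (Localization.AtPrime 𝔮) 𝔮.primeCompl_le_nonZeroDivisors
  have : algebraMap B (Localization.AtPrime 𝔮) (s * g) = algebraMap B (Localization.AtPrime 𝔮) y := by
    rw [map_mul, mul_comm]
    exact hys
  rw [hinj this]
  exact hy

/-- **Height-one criterion, fraction-field form**: an element `x` of the fraction field `K` of the Noetherian normal
domain `B` with `d·x ∈ B` lies in `B` as soon as it lies in `B_𝔮` for every height-one prime `𝔮` containing `d`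
(the height-one primes avoiding `d` impose nothing: `s = d`). [cite: Matsumura1987, Thm. 11.5 (ii) (p. 82)] -/
theorem exists_algebraMap_eq_of_forall_heightOne_mem {K : Type*} [Field K] [Algebra B K] [IsFractionRing B K]
    (x : K) {d : B} (hdx : ∃ r : B, algebraMap B K d * x = algebraMap B K r)
    (h : ∀ 𝔮 : Ideal B, 𝔮.IsPrime → 𝔮.height = 1 → d ∈ 𝔮 →
      ∃ s ∉ 𝔮, ∃ r : B, algebraMap B K s * x = algebraMap B K r) :
    ∃ y : B, algebraMap B K y = x := by
  refine Literature.RingTheory.IntegralClosure.exists_algebraMap_eq_of_forall_height_eq_one x fun P hP hP1 => ?_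
  by_cases hdP : d ∈ P
  · exact h P hP hP1 hdP
  · exact ⟨d, hdP, hdx⟩

end HeightOne

/-! ## §2 Normalized chart rings inside the fraction field -/

section Chart

variable {R : Type*} [CommRing R] {K : Type*} [Field K] [Algebra R K] [IsFractionRing R K]

/-- An `R`-subalgebra of the fraction field `K` of `R` has fraction field `K`. [folklore] -/
private theorem isFractionRing_subalgebra (B : Subalgebra R K) : IsFractionRing B K := by
  haveI : FaithfulSMul B K := (faithfulSMul_iff_algebraMap_injective B K).mpr Subtype.val_injective
  refine IsFractionRing.of_field B K fun z => ?_
  obtain ⟨x, y, -, rfl⟩ := IsFractionRing.div_surjective (A := R) z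
  exact ⟨algebraMap R B x, algebraMap R B y, rfl⟩

/-- An `R`-subalgebra of `K` which is integrally closed in `K` is an integrally closed domain. [folklore] -/
private theorem isIntegrallyClosed_subalgebra (B : Subalgebra R K) (hBint : ∀ x : K, IsIntegral B x → x ∈ B) :
    IsIntegrallyClosed B := by
  haveI := isFractionRing_subalgebra B
  refine (isIntegrallyClosed_iff_isIntegrallyClosedIn K).mpr (isIntegrallyClosedIn_iff.mpr ⟨?_, fun {x} hx => ?_⟩)
  · exact Subtype.val_injective
  · exact ⟨⟨x, hBint x hx⟩, rfl⟩

/-- **Height-one criterion on a normalized chart.** Let `B` be a Noetherian `R`-subalgebra of the fraction field `K`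
of the domain `R`, integrally closed in `K` (a chart of a normalized blow-up), `f, g ∈ R`, `f ≠ 0`. If `g ∈ f^μ B_𝔮`
for every height-one prime `𝔮 ∋ f` of `B`, then `g/f^μ ∈ B`. [cite: Matsumura1987, Thm. 11.5 (ii) (p. 82)] -/
theorem div_pow_mem_of_forall_heightOne (B : Subalgebra R K) [IsNoetherianRing B]
    (hBint : ∀ x : K, IsIntegral B x → x ∈ B) {f : R} (hf : f ≠ 0) (μ : ℕ) (g : R)
    (h : ∀ 𝔮 : Ideal B, [𝔮.IsPrime] → 𝔮.height = 1 → algebraMap R B f ∈ 𝔮 →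
      algebraMap B (Localization.AtPrime 𝔮) (algebraMap R B g) ∈
        Ideal.span {algebraMap B (Localization.AtPrime 𝔮) (algebraMap R B f) ^ μ}) :
    algebraMap R K g / algebraMap R K f ^ μ ∈ B := by
  haveI : IsIntegrallyClosed B := isIntegrallyClosed_subalgebra B hBint
  have hfK : algebraMap R K f ≠ 0 := fun h0 => hf (IsFractionRing.injective R K (by rw [h0, map_zero]))
  have hcoe : ∀ r : R, ((algebraMap R B r : B) : K) = algebraMap R K r := fun _ => rfl
  have hfB : algebraMap R B f ≠ 0 := fun h0 => hfK (by rw [← hcoe f, h0, ZeroMemClass.coe_zero])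
  have hmem : algebraMap R B g ∈ Ideal.span {algebraMap R B f ^ μ} :=
    mem_span_pow_of_forall_heightOne_localization hfB μ h
  obtain ⟨y, hy⟩ := Ideal.mem_span_singleton'.mp hmem
  have hyK : (y : K) * algebraMap R K f ^ μ = algebraMap R K g := by
    have := congrArg (fun b : B => (b : K)) hy
    simpa only [Subalgebra.coe_mul, Subalgebra.coe_pow, hcoe] using this
  rw [← hyK, mul_div_assoc, div_self (pow_ne_zero μ hfK), mul_one]
  exact y.2

/-- **Height-one criterion on a normalized chart, integrality form.** Let `C ⊆ K` be an `R`-subalgebra of the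
fraction field of the domain `R` (a blow-up chart ring `R[I/f]`) and `B ⊆ K` its integral closure in `K`, assumed
Noetherian (e.g. `R` of finite type over a field: E. Noether). If `g ∈ f^μ B_𝔮` for every height-one prime `𝔮 ∋ f`
of `B` (`f ≠ 0`), then `g/f^μ` is integral over `C` — the hypothesis shape of the chart criterion
`isIntegralOverIdeal_pow_of_forall_chart`. [cite: Matsumura1987, Thm. 11.5 (ii) (p. 82)] -/
theorem isIntegral_div_pow_of_forall_heightOne (C B : Subalgebra R K) (hB : ∀ x : K, x ∈ B ↔ IsIntegral C x)
    [IsNoetherianRing B] {f : R} (hf : f ≠ 0) (μ : ℕ) (g : R)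
    (h : ∀ 𝔮 : Ideal B, [𝔮.IsPrime] → 𝔮.height = 1 → algebraMap R B f ∈ 𝔮 →
      algebraMap B (Localization.AtPrime 𝔮) (algebraMap R B g) ∈
        Ideal.span {algebraMap B (Localization.AtPrime 𝔮) (algebraMap R B f) ^ μ}) :
    IsIntegral C (algebraMap R K g / algebraMap R K f ^ μ) := by
  -- `C ≤ B`, `B` integral over `C`, hence `B` is integrally closed in `K`
  have hCB : C ≤ B := fun x hx => (hB x).mpr (isIntegral_algebraMap (R := C) (A := K) (x := ⟨x, hx⟩))
  letI : Algebra C B := (Subalgebra.inclusion hCB).toRingHom.toAlgebra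
  haveI : IsScalarTower C B K := IsScalarTower.of_algebraMap_eq fun _ => rfl
  haveI : Algebra.IsIntegral C B := ⟨fun b => by
    have hb : IsIntegral C (b : K) := (hB b).mp b.2
    exact (isIntegral_algHom_iff (IsScalarTower.toAlgHom C B K) Subtype.val_injective).mp hb⟩
  have hBint : ∀ x : K, IsIntegral B x → x ∈ B := fun x hx => (hB x).mpr (isIntegral_trans x hx)
  exact (hB _).mp (div_pow_mem_of_forall_heightOne B hBint hf μ g h)

/-- **Integral dependence on `I^μ` is tested on the discrete valuations of the normalized blow-up of `I`** (the
composite of the chart criterion `isIntegralOverIdeal_pow_of_forall_chart` — res-D-pv-012 — with Krull's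
«`B = ⋂_{ht 𝔮 = 1} B_𝔮`» on each normalized chart): let `R` be a domain with fraction field `K`, `I = (f_i)_{i ∈ ι} ≠ 0`
finitely generated, and for each `i` with `f_i ≠ 0` let `B_i ⊆ K` be the integral closure of the chart ring
`R[I/f_i]`, assumed Noetherian. If for every such `i` and every height-one prime `𝔮` of `B_i` containing `f_i` one has
`g ∈ f_i^μ (B_i)_𝔮` (i.e. `v_𝔮(g) ≥ μ·v_𝔮(f_i)` in the discrete valuation ring `(B_i)_𝔮`), then `g` is integral over
`I^μ`. [cite: HunekeSwanson2006, Thm. 10.2.2 (3)] -/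
theorem isIntegralOverIdeal_pow_of_forall_chart_heightOne {I : Ideal R} {ι : Type*} [Fintype ι] (f : ι → R)
    (hf : Ideal.span (Set.range f) = I) (hI : I ≠ ⊥) (μ : ℕ) (g : R) (B : ι → Subalgebra R K)
    (hB : ∀ i, f i ≠ 0 → ∀ x : K, x ∈ B i ↔
      IsIntegral (Algebra.adjoin R ((fun h : R => algebraMap R K h / algebraMap R K (f i)) '' (I : Set R))) x)
    [∀ i, IsNoetherianRing (B i)]
    (h : ∀ i, f i ≠ 0 → ∀ 𝔮 : Ideal (B i), [𝔮.IsPrime] → 𝔮.height = 1 → algebraMap R (B i) (f i) ∈ 𝔮 →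
      algebraMap (B i) (Localization.AtPrime 𝔮) (algebraMap R (B i) g) ∈
        Ideal.span {algebraMap (B i) (Localization.AtPrime 𝔮) (algebraMap R (B i) (f i)) ^ μ}) :
    IsIntegralOverIdeal (I ^ μ) g :=
  isIntegralOverIdeal_pow_of_forall_chart (IsFractionRing.injective R K) f hf hI μ g fun i hi =>
    isIntegral_div_pow_of_forall_heightOne _ (B i) (hB i hi) hi μ g (h i hi)

end Chart

/-! ## §3 (rev 2) Presentation-agnostic forms: any localization model at `𝔮`, and the discrete-valuation reading

The consumers of §2 meet the local rings `(B_i)_𝔮` as STALKS of schemes (any `IsLocalization.AtPrime` model, not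
literally `Localization.AtPrime 𝔮`) and obtain order bounds `g ∈ 𝔪^m`, `f ∉ 𝔪^{n+1}` with `μ·n ≤ m` there (from
[Hironaka2005]'s numerical exponent theorem). The lemmas below convert such data into the hypotheses of §1–§2. -/

section Agnostic

variable {B : Type*} [CommRing B] [IsDomain B]

/-- **From a localization model back to the ring**: if the image of `g` lies in `f^μ R_𝔮` in SOME localization `R_𝔮`
of the domain `B` at the prime `𝔮` (any `IsLocalization.AtPrime` model, e.g. a stalk), then `s·g ∈ f^μ B` for some
`s ∉ 𝔮` (extension and contraction of ideals under localization). [cite: Matsumura1987, Thm. 4.1 (p. 22)] -/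
theorem exists_mul_mem_span_pow_of_isLocalization (𝔮 : Ideal B) [𝔮.IsPrime] (Rq : Type*) [CommRing Rq]
    [Algebra B Rq] [IsLocalization.AtPrime Rq 𝔮] {f g : B} {μ : ℕ}
    (h : algebraMap B Rq g ∈ Ideal.span {algebraMap B Rq f ^ μ}) :
    ∃ s ∉ 𝔮, s * g ∈ Ideal.span {f ^ μ} := by
  rw [← map_pow, ← Set.image_singleton, ← Ideal.map_span] at h
  obtain ⟨⟨⟨y, hy⟩, ⟨s, hs⟩⟩, hys⟩ := (IsLocalization.mem_map_algebraMap_iff 𝔮.primeCompl Rq).mp h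
  refine ⟨s, hs, ?_⟩
  have hinj := IsLocalization.injective Rq 𝔮.primeCompl_le_nonZeroDivisors
  have : algebraMap B Rq (s * g) = algebraMap B Rq y := by
    rw [map_mul, mul_comm]
    exact hys
  rw [hinj this]
  exact hy

/-- **The discrete-valuation reading of «`g ∈ f^μ R`»**: in a discrete valuation ring `R`, if `f ∉ 𝔪^{n+1}`
(`v(f) ≤ n`), `g ∈ 𝔪^m` (`v(g) ≥ m`) and `μ·n ≤ m`, then `g ∈ f^μ R`. (With `n = v(f)`, `m = v(g)` this is
«`v(g) ≥ μ·v(f) ⇒ g ∈ f^μ R`»; every non-zero element of a DVR is a unit times a power of the uniformizer.)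
[cite: Matsumura1987, Thm. 11.1 and Thm. 11.2 (p. 78–79)] -/
theorem mem_span_pow_of_maximalIdeal_pow {R : Type*} [CommRing R] [IsDomain R] [IsDiscreteValuationRing R]
    {f g : R} {n m μ : ℕ} (hf : f ∉ IsLocalRing.maximalIdeal R ^ (n + 1))
    (hg : g ∈ IsLocalRing.maximalIdeal R ^ m) (hμ : μ * n ≤ m) : g ∈ Ideal.span {f ^ μ} := by
  obtain ⟨ϖ, hϖ⟩ := IsDiscreteValuationRing.exists_irreducible R
  have hmax : IsLocalRing.maximalIdeal R = Ideal.span {ϖ} := hϖ.maximalIdeal_eq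
  have hf0 : f ≠ 0 := fun h0 => hf (by rw [h0]; exact Ideal.zero_mem _)
  obtain ⟨k, u, hfk⟩ := IsDiscreteValuationRing.eq_unit_mul_pow_irreducible hf0 hϖ
  -- `k ≤ n`
  have hkn : k ≤ n := by
    by_contra hlt
    apply hf
    rw [hmax, Ideal.span_singleton_pow, Ideal.mem_span_singleton, hfk]
    exact (pow_dvd_pow ϖ (by omega)).mul_left _
  -- `f^μ ∣ ϖ^{kμ} ∣ ϖ^m ∣ g`
  rw [Ideal.mem_span_singleton]
  rw [hmax, Ideal.span_singleton_pow, Ideal.mem_span_singleton] at hg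
  have h1 : f ^ μ ∣ ϖ ^ (k * μ) := by
    refine ⟨((u⁻¹ : Rˣ) : R) ^ μ, ?_⟩
    rw [hfk, mul_pow, ← pow_mul, mul_right_comm, ← mul_pow, Units.mul_inv, one_pow, one_mul]
  exact h1.trans ((pow_dvd_pow ϖ (by nlinarith)).trans hg)

variable [IsNoetherianRing B] [IsIntegrallyClosed B]

/-- **Height-one criterion, any localization models**: if for every height-one prime `𝔮 ∋ f` there is SOME localization
model `R_𝔮` of `B` at `𝔮` in which the image of `g` lies in `f^μ R_𝔮`, then `g ∈ f^μ B` (`f ≠ 0`).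
[cite: Matsumura1987, Thm. 11.5 (ii) (p. 82)] -/
theorem mem_span_pow_of_forall_heightOne_isLocalization {f : B} (hf : f ≠ 0) (μ : ℕ) {g : B}
    (h : ∀ 𝔮 : Ideal B, [𝔮.IsPrime] → 𝔮.height = 1 → f ∈ 𝔮 →
      ∃ (Rq : Type*) (_ : CommRing Rq) (_ : Algebra B Rq) (_ : IsLocalization.AtPrime Rq 𝔮),
        algebraMap B Rq g ∈ Ideal.span {algebraMap B Rq f ^ μ}) :
    g ∈ Ideal.span {f ^ μ} := by
  refine mem_span_pow_of_forall_heightOne hf μ fun 𝔮 h𝔮 h1 hf𝔮 => ?_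
  haveI := h𝔮
  obtain ⟨Rq, _, _, _, hmem⟩ := h 𝔮 h1 hf𝔮
  exact exists_mul_mem_span_pow_of_isLocalization 𝔮 Rq hmem

end Agnostic

section ChartAgnostic

variable {R : Type*} [CommRing R] {K : Type*} [Field K] [Algebra R K] [IsFractionRing R K]

/-- **Height-one criterion on a normalized chart, ring form of the hypothesis** (`∃ s ∉ 𝔮, s·g ∈ f^μ B`, as produced
by `exists_mul_mem_span_pow_of_isLocalization` from any localization model / stalk): `g/f^μ ∈ B`.
[cite: Matsumura1987, Thm. 11.5 (ii) (p. 82)] -/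
theorem div_pow_mem_of_forall_heightOne' (B : Subalgebra R K) [IsNoetherianRing B]
    (hBint : ∀ x : K, IsIntegral B x → x ∈ B) {f : R} (hf : f ≠ 0) (μ : ℕ) (g : R)
    (h : ∀ 𝔮 : Ideal B, 𝔮.IsPrime → 𝔮.height = 1 → algebraMap R B f ∈ 𝔮 →
      ∃ s ∉ 𝔮, s * algebraMap R B g ∈ Ideal.span {algebraMap R B f ^ μ}) :
    algebraMap R K g / algebraMap R K f ^ μ ∈ B := by
  haveI : IsIntegrallyClosed B := isIntegrallyClosed_subalgebra B hBint
  have hfK : algebraMap R K f ≠ 0 := fun h0 => hf (IsFractionRing.injective R K (by rw [h0, map_zero]))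
  have hcoe : ∀ r : R, ((algebraMap R B r : B) : K) = algebraMap R K r := fun _ => rfl
  have hfB : algebraMap R B f ≠ 0 := fun h0 => hfK (by rw [← hcoe f, h0, ZeroMemClass.coe_zero])
  have hmem : algebraMap R B g ∈ Ideal.span {algebraMap R B f ^ μ} := mem_span_pow_of_forall_heightOne hfB μ h
  obtain ⟨y, hy⟩ := Ideal.mem_span_singleton'.mp hmem
  have hyK : (y : K) * algebraMap R K f ^ μ = algebraMap R K g := by
    have := congrArg (fun b : B => (b : K)) hy
    simpa only [Subalgebra.coe_mul, Subalgebra.coe_pow, hcoe] using this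
  rw [← hyK, mul_div_assoc, div_self (pow_ne_zero μ hfK), mul_one]
  exact y.2

/-- **Height-one criterion on a normalized chart, integrality form, ring-form hypothesis.**
[cite: Matsumura1987, Thm. 11.5 (ii) (p. 82)] -/
theorem isIntegral_div_pow_of_forall_heightOne' (C B : Subalgebra R K) (hB : ∀ x : K, x ∈ B ↔ IsIntegral C x)
    [IsNoetherianRing B] {f : R} (hf : f ≠ 0) (μ : ℕ) (g : R)
    (h : ∀ 𝔮 : Ideal B, 𝔮.IsPrime → 𝔮.height = 1 → algebraMap R B f ∈ 𝔮 →
      ∃ s ∉ 𝔮, s * algebraMap R B g ∈ Ideal.span {algebraMap R B f ^ μ}) :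
    IsIntegral C (algebraMap R K g / algebraMap R K f ^ μ) := by
  have hCB : C ≤ B := fun x hx => (hB x).mpr (isIntegral_algebraMap (R := C) (A := K) (x := ⟨x, hx⟩))
  letI : Algebra C B := (Subalgebra.inclusion hCB).toRingHom.toAlgebra
  haveI : IsScalarTower C B K := IsScalarTower.of_algebraMap_eq fun _ => rfl
  haveI : Algebra.IsIntegral C B := ⟨fun b => by
    have hb : IsIntegral C (b : K) := (hB b).mp b.2
    exact (isIntegral_algHom_iff (IsScalarTower.toAlgHom C B K) Subtype.val_injective).mp hb⟩
  have hBint : ∀ x : K, IsIntegral B x → x ∈ B := fun x hx => (hB x).mpr (isIntegral_trans x hx)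
  exact (hB _).mp (div_pow_mem_of_forall_heightOne' B hBint hf μ g h)

/-- **Integral dependence on `I^μ` is tested at the height-one primes of the normalized charts — ring-form
hypothesis** (`∃ s ∉ 𝔮, s·g ∈ f_i^μ B_i`, obtained from ANY localization model or stalk by
`exists_mul_mem_span_pow_of_isLocalization`, and in a DVR from order bounds by `mem_span_pow_of_maximalIdeal_pow`).
[cite: HunekeSwanson2006, Thm. 10.2.2 (3)] -/
theorem isIntegralOverIdeal_pow_of_forall_chart_heightOne' [IsDomain R] {I : Ideal R} {ι : Type*} [Fintype ι]
    (f : ι → R) (hf : Ideal.span (Set.range f) = I) (hI : I ≠ ⊥) (μ : ℕ) (g : R) (B : ι → Subalgebra R K)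
    (hB : ∀ i, f i ≠ 0 → ∀ x : K, x ∈ B i ↔
      IsIntegral (Algebra.adjoin R ((fun h : R => algebraMap R K h / algebraMap R K (f i)) '' (I : Set R))) x)
    [∀ i, IsNoetherianRing (B i)]
    (h : ∀ i, f i ≠ 0 → ∀ 𝔮 : Ideal (B i), 𝔮.IsPrime → 𝔮.height = 1 → algebraMap R (B i) (f i) ∈ 𝔮 →
      ∃ s ∉ 𝔮, s * algebraMap R (B i) g ∈ Ideal.span {algebraMap R (B i) (f i) ^ μ}) :
    IsIntegralOverIdeal (I ^ μ) g :=
  isIntegralOverIdeal_pow_of_forall_chart (IsFractionRing.injective R K) f hf hI μ g fun i hi =>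
    isIntegral_div_pow_of_forall_heightOne' _ (B i) (hB i hi) hi μ g (h i hi)

end ChartAgnostic

/-! ## §4 (rev 3) The normalized charts exist and are Noetherian (E. Noether), and the callback form of the reduction

For `R` a domain of finite type over a field `k` (more generally essentially of finite type) the integral closure of a
chart ring `R[I/f] ⊆ K = Frac R` is a finitely generated `R`-algebra (tree `exists_adjoin_eq_integralClosure_adjoin`,
Liu Prop. 4.1.27 / EGA IV 7.7.3), hence Noetherian; so the consumer of `isIntegralOverIdeal_pow_of_forall_chart_heightOne'`
only has to prove the per-prime statement for an ARBITRARY Noetherian normalization handed to it («callback» form). -/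

section NormalizedCharts

universe u

variable {k R K : Type u} [Field k] [CommRing R] [Algebra k R] [Field K] [Algebra R K]
  [IsFractionRing R K] [Algebra k K] [IsScalarTower k R K]

/-- **The normalization of a blow-up chart ring is a Noetherian subalgebra of `K`** (`R` a domain essentially of finite
type over a field `k`, `K = Frac R`): for a finite `S ⊆ R` and `f ∈ R` there is a Noetherian `R`-subalgebra `B ⊆ K` whose
elements are exactly the elements of `K` integral over the chart ring `R[(S)/f] = R[h/f : h ∈ (S)]` (E. Noether's
finiteness of the integral closure for domains of finite type over a field). [cite: Liu2002, Prop. 4.1.27, p. 122] -/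
theorem exists_noetherian_normalizedChart [Algebra.EssFiniteType k R] (S : Finset R) (f : R) :
    ∃ B : Subalgebra R K, IsNoetherianRing B ∧ ∀ x : K, x ∈ B ↔
      IsIntegral (Algebra.adjoin R ((fun h : R => algebraMap R K h / algebraMap R K f) ''
        (Ideal.span (S : Set R) : Set R))) x := by
  classical
  haveI : IsNoetherianRing R := Algebra.EssFiniteType.isNoetherianRing k R
  let s : Finset K := S.image fun h : R => algebraMap R K h / algebraMap R K f
  obtain ⟨t, -, ht, -⟩ := exists_adjoin_eq_integralClosure_adjoin (k := k) (A := R) (K := K) s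
  have hs : Algebra.adjoin R (s : Set K) =
      Algebra.adjoin R ((fun h : R => algebraMap R K h / algebraMap R K f) '' (Ideal.span (S : Set R) : Set R)) := by
    rw [Finset.coe_image, adjoin_div_image_span]
  refine ⟨Algebra.adjoin R (t : Set K), ?_, fun x => ?_⟩
  · haveI : Algebra.FiniteType R (Algebra.adjoin R (t : Set K)) :=
      (Subalgebra.fg_iff_finiteType _).mp (Subalgebra.fg_adjoin_finset t)
    exact Algebra.FiniteType.isNoetherianRing R _
  · rw [ht x, hs]

omit [Algebra k R] [Algebra k K] [IsScalarTower k R K] in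
/-- **Integral dependence on `I^μ`, callback form of the height-one reduction.** `R ⊆ K = Frac R` a domain, `I = (S) ≠ 0`
with `S` finite, `g ∈ R`. Suppose every non-zero `f ∈ S` admits SOME Noetherian `R`-subalgebra `B ⊆ K` consisting of the
elements integral over the chart ring `R[I/f]` (e.g. `exists_noetherian_normalizedChart`), and that for EVERY such `B` and
every height-one prime `𝔮 ∋ f` of `B` one has `s·g ∈ f^μ B` for some `s ∉ 𝔮`. Then `g` is integral over `I^μ`.
[cite: HunekeSwanson2006, Thm. 10.2.2 (3)] -/
theorem isIntegralOverIdeal_pow_of_forall_normalizedChart {I : Ideal R} (S : Finset R)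
    (hS : Ideal.span (S : Set R) = I) (hI : I ≠ ⊥) (μ : ℕ) (g : R)
    (hex : ∀ f ∈ S, f ≠ 0 → ∃ B : Subalgebra R K, IsNoetherianRing B ∧ ∀ x : K, x ∈ B ↔
      IsIntegral (Algebra.adjoin R ((fun h : R => algebraMap R K h / algebraMap R K f) '' (I : Set R))) x)
    (h : ∀ f ∈ S, f ≠ 0 → ∀ (B : Subalgebra R K), IsNoetherianRing B →
      (∀ x : K, x ∈ B ↔
        IsIntegral (Algebra.adjoin R ((fun h : R => algebraMap R K h / algebraMap R K f) '' (I : Set R))) x) →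
      ∀ 𝔮 : Ideal B, 𝔮.IsPrime → 𝔮.height = 1 → algebraMap R B f ∈ 𝔮 →
        ∃ s ∉ 𝔮, s * algebraMap R B g ∈ Ideal.span {algebraMap R B f ^ μ}) :
    IsIntegralOverIdeal (I ^ μ) g := by
  refine isIntegralOverIdeal_pow_of_forall_isIntegral_adjoin_div (IsFractionRing.injective R K) S hS hI μ g
    fun f hf hf0 => ?_
  obtain ⟨B, hBN, hB⟩ := hex f hf hf0
  haveI := hBN
  exact isIntegral_div_pow_of_forall_heightOne' _ B hB hf0 μ g (h f hf hf0 B hBN hB)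

/-- **The same over a field** (`R` essentially of finite type over `k`, e.g. of finite type): the normalizations exist by
`exists_noetherian_normalizedChart`, so only the per-prime callback remains — for every non-zero generator `f`, every
Noetherian `R`-subalgebra `B ⊆ K` cut out by integrality over `R[I/f]`, and every height-one prime `𝔮 ∋ f` of `B`:
`s·g ∈ f^μ B` for some `s ∉ 𝔮`. (In the application to [Hironaka2005] §12 (♭) this callback is «STEP C» of the cell's
signature sheet, read through `exists_mul_mem_span_pow_of_isLocalization`; `B_𝔮` is a DVR by
`isDiscreteValuationRing_of_height_eq_one`, `B` being integrally closed in `K = Frac B`.)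
[cite: HunekeSwanson2006, Thm. 10.2.2 (3)] [cite: Liu2002, Prop. 4.1.27, p. 122] -/
theorem isIntegralOverIdeal_pow_of_forall_normalizedChart_of_essFiniteType [Algebra.EssFiniteType k R]
    {I : Ideal R} (S : Finset R) (hS : Ideal.span (S : Set R) = I) (hI : I ≠ ⊥) (μ : ℕ) (g : R)
    (h : ∀ f ∈ S, f ≠ 0 → ∀ (B : Subalgebra R K), IsNoetherianRing B →
      (∀ x : K, x ∈ B ↔
        IsIntegral (Algebra.adjoin R ((fun h : R => algebraMap R K h / algebraMap R K f) '' (I : Set R))) x) →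
      ∀ 𝔮 : Ideal B, 𝔮.IsPrime → 𝔮.height = 1 → algebraMap R B f ∈ 𝔮 →
        ∃ s ∉ 𝔮, s * algebraMap R B g ∈ Ideal.span {algebraMap R B f ^ μ}) :
    IsIntegralOverIdeal (I ^ μ) g := by
  refine isIntegralOverIdeal_pow_of_forall_normalizedChart (K := K) S hS hI μ g (fun f _ _ => ?_) h
  obtain ⟨B, hBN, hB⟩ := exists_noetherian_normalizedChart (k := k) (K := K) S f
  exact ⟨B, hBN, fun x => by rw [hB x, hS]⟩

end NormalizedCharts


end Hironaka2005

end Literature.AlgebraicGeometry.Resolution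

end
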